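import Summits.MatrixMultiplication.OmegaCensus.STPPAlignedDoubleKneserFilter

/-!
# ω-census (abelian STPP census): filter N19 — the INVOLUTION CLASH (Kneser structure ⇒ TPP contradiction; kernel)

HONEST FRAMING (pub-omega census; verbatim): lottery ticket; floor = certified bounds/negative ranges.
Census BOOKKEEPING / STRUCTURE (seat pub-omega-stpp-1 gen 27, 2026-08-27), family (b2).  A necessary condition on STPP families in finite
abelian groups whose order is NOT divisible by `4` — a tool for EXCLUDING candidate block patterns by theorem; nothing here is progress on `ω`.

## Statement

Setting of N16–N18 (`STPPAlignedDoubleKneserFilter.lean`): STPP family with non-empty sets in a finite abelian `H`, `|H| = n`, `N ≥ 2`; block `i`,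
`vol = aᵢbᵢcᵢ`, `Y° = ⋃_{k≠i}(C_k − B_k)`, `Z° = ⋃_{k≠i}(C_k − A_k)`, `W = Cᵢ − Aᵢ − Bᵢ`, `V = W ⊔ ((−Aᵢ) + Y°)`, `Bᵢ + V ⊆ H ∖ Z°`; the two Kneser
stabilizers `K = Stab(Bᵢ + V)`, `K′ = Stab((−Aᵢ) + Y°)`.  N18 says that `(|K|, |K′|)` is a RESCUING PAIR: `|Z°| + kLB(bᵢ, vol + kLB(aᵢ, |Y°|, |K′|), |K|) ≤ n`.

**N19 (involution clash).**  Suppose `4 ∤ n` (so `H` has at most one element of order `2`: `eq_of_add_self_eq_zero`).  If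
(1) every rescuing pair `(d, d′)` of divisors of `n` is `(2, 2)`;
(2) for every `t ≤ n` with `kLB(bᵢ, t, 2) ≤ n − |Z°|`:  `t + 2 < 2aᵢ + vol + |Y°|`;
(3) `n + 2 < 2bᵢ + |Z°| + vol + kLB(aᵢ, |Y°|, 2)`;
then the pattern carries no STPP family.  PROOF.  By N18 and (1), `|K| = |K′| = 2`, say `K = {0, κ}`, `K′ = {0, κ′}` with `2κ = 2κ′ = 0`, hence `κ = κ′ =: ι`
(unique involution).  Kneser's STRUCTURE inequalities `|S + K′| + |Y° + K′| ≤ |S + Y°| + 2` (`S = −Aᵢ`) and `|Bᵢ + K| + |V + K| ≤ |Bᵢ + V| + 2`, with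
`|S + Y°| = |V| − vol`, `kLB(bᵢ, |V|, 2) ≤ |Bᵢ + V| ≤ n − |Z°|` and (2), give `|S + K′| < 2aᵢ`; with `|V| ≥ vol + kLB(aᵢ, |Y°|, 2)` and (3) they give
`|Bᵢ + K| < 2bᵢ`.  A set `T` with `|T + {0, ι}| < 2|T|` contains two points `t, t + ι` (`exists_add_mem_of_card_add_lt`).  So `a₁ − a₂ = ι = b₂ − b₁` for some
`a₁, a₂ ∈ Aᵢ`, `b₁, b₂ ∈ Bᵢ`, and `(a₁ − a₂) + (b₁ − b₂) + (c − c) = 0` contradicts the TPP of block `i` (Def. 5.1, pattern `(i,i,i)`).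
Decidable card-vector predicate `N19Dead` (six role readings, the hypothesis `4 ∤ n` inside) with `not_isSTPP_of_n19Dead{1,,'}`.

SCOPE.  `4 ∤ n` covers every group of order `2·odd` (ℤ₅₈, ℤ₆₂, ℤ₆₆, ℤ₇₀, …; for squarefree such `n` the cyclic group is the only abelian group) and all odd
orders (where the filter is void: no involution, rescuing pairs are never `(2,2)`).  Measured bite (HOME `pub-omega-stpp-1-g27/fronts/`, python reader
`n19_filter.py`): ℤ₅₈ residual front 35 (after N7–N12, N16–N18) → **25**; ℤ₅₇/ℤ₅₉ unchanged (odd); the 17 abelian logs: cores 517/4 025, UNSAT 1 011/5 588;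
abelian `≤ 16` census 26/201 INFEASIBLE items.  SOUNDNESS of the arithmetic: 0/568 FEASIBLE, 0/1 984 SAT-witnessed patterns (orders 48–57, incl. the
`4 ∤ n` orders 50, 54 and the odd ones).

References: M. Kneser, Math. Z. 58 (1953) (tree: `Literature.Combinatorics.Additive.add_kneser`, structural form with the stabilizer); H. Cohn, R. Kleinberg,
B. Szegedy, C. Umans, FOCS 2005 (arXiv:math/0511460), Def. 5.1.
-/

open Finset
open scoped Pointwise

namespace Summit.MatrixMultiplication.OmegaCensus.CubeNB

open Literature.Computability.AlgebraicComplexity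
open Summit.MatrixMultiplication.OmegaCensus.STPPKneser

variable {H : Type*} [AddCommGroup H] [DecidableEq H] [Fintype H] {N : ℕ} {A B C : Fin N → Finset H}

/-! ## §1 Group-theoretic and sumset lemmas -/

section Lemmas

/-- In a finite abelian group whose order is not divisible by `4` there is at most one element of order `2`: two distinct ones `x, y` would span the
subgroup `{0, x, y, x + y}` of order `4` (Lagrange). [folklore] -/
theorem eq_of_add_self_eq_zero (h4 : ¬ 4 ∣ Fintype.card H) {x y : H} (hx : x ≠ 0) (hy : y ≠ 0)
    (h2x : x + x = 0) (h2y : y + y = 0) : x = y := by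
  by_contra hxy
  have hnx : -x = x := neg_eq_iff_add_eq_zero.2 h2x
  have hny : -y = y := neg_eq_iff_add_eq_zero.2 h2y
  have hxy0 : x + y ≠ 0 := fun h => hxy (by rw [← hnx]; exact neg_eq_iff_add_eq_zero.2 h |>.symm ▸ rfl)
  have hxxy : x + (x + y) = y := by rw [← add_assoc, h2x, zero_add]
  have hyxy : y + (x + y) = x := by rw [add_left_comm, h2y, add_zero]
  have hxyx : x + y + x = y := by rw [add_comm, hxxy]
  have hxyy : x + y + y = x := by rw [add_assoc, h2y, add_zero]
  have hxyxy : x + y + (x + y) = 0 := by rw [add_add_add_comm, h2x, h2y, add_zero]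
  have hyx : y + x = x + y := add_comm y x
  let D : Finset H := {0, x, y, x + y}
  have hD : ∀ u ∈ D, ∀ v ∈ D, u + v ∈ D := by
    intro u hu v hv
    simp only [D, Finset.mem_insert, Finset.mem_singleton] at hu hv ⊢
    rcases hu with rfl | rfl | rfl | rfl <;> rcases hv with rfl | rfl | rfl | rfl <;>
      simp only [add_zero, zero_add, h2x, h2y, hxxy, hyxy, hxyx, hxyy, hxyxy, hyx, true_or, or_true]
  have hDneg : ∀ u ∈ D, -u ∈ D := by
    intro u hu
    simp only [D, Finset.mem_insert, Finset.mem_singleton] at hu ⊢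
    rcases hu with rfl | rfl | rfl | rfl
    · simp
    · simp [hnx]
    · simp [hny]
    · right; right; right; rw [neg_add, hnx, hny, add_comm]
  let K : AddSubgroup H :=
    { carrier := ↑D
      add_mem' := fun {u v} hu hv => by exact_mod_cast hD u (by exact_mod_cast hu) v (by exact_mod_cast hv)
      zero_mem' := by simp [D]
      neg_mem' := fun {u} hu => by exact_mod_cast hDneg u (by exact_mod_cast hu) }
  have hKcard : Nat.card K = #D := by
    rw [← Nat.card_eq_finsetCard]; rfl
  have hD4 : #D = 4 := by
    have h1 : (0 : H) ∉ ({x, y, x + y} : Finset H) := by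
      simp only [Finset.mem_insert, Finset.mem_singleton, not_or]
      exact ⟨hx.symm, hy.symm, hxy0.symm⟩
    have h2 : x ∉ ({y, x + y} : Finset H) := by
      simp only [Finset.mem_insert, Finset.mem_singleton, not_or]
      exact ⟨hxy, fun h => hy (by simpa using h.symm)⟩
    have h3 : y ∉ ({x + y} : Finset H) := by
      simp only [Finset.mem_singleton]
      exact fun h => hx (by simpa using h.symm)
    simp only [D, Finset.card_insert_of_notMem h1, Finset.card_insert_of_notMem h2, Finset.card_insert_of_notMem h3,
      Finset.card_singleton]
  have hdvd : Nat.card K ∣ Nat.card H := AddSubgroup.card_addSubgroup_dvd_card K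
  rw [hKcard, hD4, Nat.card_eq_fintype_card] at hdvd
  exact h4 hdvd

omit [Fintype H] in
/-- If `0, k ∈ K` and `|T + K| < 2|T|` then `T` contains two points differing by `k` (`T` and `T + k` are two translates inside `T + K`). [folklore] -/
theorem exists_add_mem_of_card_add_lt {T K : Finset H} {k : H} (h0 : (0 : H) ∈ K) (hk : k ∈ K)
    (hlt : #(T + K) < 2 * #T) : ∃ x ∈ T, x + k ∈ T := by
  by_contra h
  push Not at h
  have hsub1 : T ⊆ T + K := fun x hx => Finset.mem_add.2 ⟨x, hx, 0, h0, add_zero x⟩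
  have hsub2 : T.image (fun x => x + k) ⊆ T + K := by
    intro y hy
    obtain ⟨x, hx, rfl⟩ := Finset.mem_image.1 hy
    exact Finset.mem_add.2 ⟨x, hx, k, hk, rfl⟩
  have hdisj : Disjoint T (T.image fun x => x + k) := by
    rw [Finset.disjoint_left]
    intro y hy hy'
    obtain ⟨x, hx, rfl⟩ := Finset.mem_image.1 hy'
    exact h x hx hy
  have hcard : #(T ∪ T.image (fun x => x + k)) = #T + #T := by
    rw [Finset.card_union_of_disjoint hdisj, Finset.card_image_of_injective _ (add_left_injective k)]
  have := Finset.card_le_card (Finset.union_subset hsub1 hsub2)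
  omega

omit [Fintype H] in
/-- A stabilizer of cardinality `2` is `{0, κ}` with `κ ≠ 0` and `κ + κ = 0`. [cite: Nathanson1996, §4.1] -/
theorem exists_involution_of_card_addStab_eq_two {s : Finset H} (hs : s.Nonempty) (h2 : #s.addStab = 2) :
    ∃ κ : H, κ ≠ 0 ∧ κ + κ = 0 ∧ κ ∈ s.addStab := by
  have h0 : (0 : H) ∈ s.addStab := Finset.zero_mem_addStab.2 hs
  obtain ⟨κ, hκ⟩ : (s.addStab.erase 0).Nonempty := by
    rw [← Finset.card_pos, Finset.card_erase_of_mem h0, h2]; norm_num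
  have hκ0 : κ ≠ 0 := Finset.ne_of_mem_erase hκ
  have hκm : κ ∈ s.addStab := Finset.mem_of_mem_erase hκ
  have hκs : κ +ᵥ s = s := (Finset.mem_addStab hs).1 hκm
  have h2κ : κ + κ ∈ s.addStab := by
    rw [Finset.mem_addStab hs, ← vadd_vadd, hκs, hκs]
  have hpair : ({0, κ} : Finset H) = s.addStab := by
    apply Finset.eq_of_subset_of_card_le
    · intro z hz
      rcases Finset.mem_insert.1 hz with rfl | hz
      · exact h0
      · rw [Finset.mem_singleton.1 hz]; exact hκm
    · rw [h2, Finset.card_pair hκ0.symm]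
  rw [← hpair, Finset.mem_insert, Finset.mem_singleton] at h2κ
  rcases h2κ with h | h
  · exact ⟨κ, hκ0, h, hκm⟩
  · exact absurd (add_eq_left.1 h) hκ0

omit [Fintype H] in
/-- Kneser's lower bound for a GIVEN stabilizer order: `kLB(|S|, |T|, |Stab(S+T)|) ≤ |S + T|` (the step inside `exists_dvd_kneserLB_le_card_add`).
[cite: Kneser1953] -/
theorem kneserLB_card_addStab_le (S T : Finset H) (hS : S.Nonempty) (hT : T.Nonempty) :
    kneserLB #S #T #(S + T).addStab ≤ #(S + T) := by
  have hkn := Literature.Combinatorics.Additive.add_kneser S T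
  set K := (S + T).addStab with hK
  have hKne : K.Nonempty := (hS.add hT).addStab
  have h1 : (#S + #K - 1) / #K * #K ≤ #(S + K) :=
    ceilDiv_mul_le_of_dvd hKne.card_pos (Finset.card_addStab_dvd_card_add_addStab S (S + T)) (card_le_card_add_right hKne)
  have h2 : (#T + #K - 1) / #K * #K ≤ #(T + K) :=
    ceilDiv_mul_le_of_dvd hKne.card_pos (Finset.card_addStab_dvd_card_add_addStab T (S + T)) (card_le_card_add_right hKne)
  unfold kneserLB
  have : ((#S + #K - 1) / #K + (#T + #K - 1) / #K - 1) * #K =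
      (#S + #K - 1) / #K * #K + (#T + #K - 1) / #K * #K - #K := by
    rw [Nat.sub_mul, Nat.add_mul, one_mul]
  rw [this]
  omega

end Lemmas

/-! ## §2 The involution clash -/

section Law

/-- **N19 (involution clash), `C`-reading.**  See the module docstring: if `4 ∤ |H|` and the three numerical conditions hold at block `i` (with another block
present), an STPP family with non-empty sets cannot have these cards. [cite: Kneser1953] [cite: CohnKleinbergSzegedyUmans2005, Def. 5.1] -/
theorem involution_clash (hS : IsSTPP A B C) (hA : ∀ i, (A i).Nonempty) (hB : ∀ i, (B i).Nonempty)
    (hC : ∀ i, (C i).Nonempty) (h4 : ¬ 4 ∣ Fintype.card H) (i : Fin N) (hI : (univ.erase i : Finset (Fin N)).Nonempty)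
    (h1 : ∀ d d' : ℕ, 0 < d → d ∣ Fintype.card H → 0 < d' → d' ∣ Fintype.card H →
      ∑ k ∈ univ.erase i, #(A k) * #(C k) +
        kneserLB #(B i) (#(A i) * #(B i) * #(C i) + kneserLB #(A i) (∑ k ∈ univ.erase i, #(B k) * #(C k)) d') d ≤
          Fintype.card H → d = 2 ∧ d' = 2)
    (h2 : ∀ t : ℕ, t ≤ Fintype.card H → kneserLB #(B i) t 2 + ∑ k ∈ univ.erase i, #(A k) * #(C k) ≤ Fintype.card H →
      t + 2 < 2 * #(A i) + #(A i) * #(B i) * #(C i) + ∑ k ∈ univ.erase i, #(B k) * #(C k))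
    (h3 : Fintype.card H + 2 < 2 * #(B i) + ∑ k ∈ univ.erase i, #(A k) * #(C k) + #(A i) * #(B i) * #(C i) +
      kneserLB #(A i) (∑ k ∈ univ.erase i, #(B k) * #(C k)) 2) : False := by
  -- the sets
  set W := ((A i) ×ˢ ((B i) ×ˢ (C i))).image fun q : H × H × H => (0 : H) + q.2.2 - q.1 - q.2.1 with hW
  set S := (A i).image (fun a => (0 : H) - a) with hSdef
  set Yo := DU B C (univ.erase i) with hYo
  set Zo := DU A C (univ.erase i) with hZo
  set V := W ∪ (S + Yo) with hV
  have hWcard : #W = #(A i) * #(B i) * #(C i) := card_image_blockSum hS i 0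
  have hScard : #S = #(A i) := Finset.card_image_of_injective _ (sub_right_injective)
  have hYcard : #Yo = ∑ k ∈ univ.erase i, #(B k) * #(C k) := card_DU_BC hS hA _
  have hZcard : #Zo = ∑ k ∈ univ.erase i, #(A k) * #(C k) := card_DU_AC hS hB _
  have hSne : S.Nonempty := (hA i).image _
  have hYne : Yo.Nonempty := DU_nonempty hI hB hC
  have hSYne : (S + Yo).Nonempty := hSne.add hYne
  have hWV : Disjoint W (S + Yo) := disjoint_W_negA_add_DU hS i
  have hVcard : #V = #W + #(S + Yo) := Finset.card_union_of_disjoint hWV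
  have hVne : V.Nonempty := hSYne.mono Finset.subset_union_right
  have hBVne : (B i + V).Nonempty := (hB i).add hVne
  -- the inclusion Bᵢ + V ⊆ H ∖ Z°
  have hU : #(univ \ Zo) = Fintype.card H - #Zo := by
    rw [Finset.card_sdiff_of_subset (Finset.subset_univ _), Finset.card_univ]
  have hZle : #Zo ≤ Fintype.card H := Finset.card_le_univ _
  have hsub0 := Finset.card_le_card (B_add_W_union_negA_add_subset hS i)
  rw [hU] at hsub0
  have hsub : #(B i + V) ≤ Fintype.card H - #Zo := hsub0
  -- the two stabilizers
  set K := (B i + V).addStab with hK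
  set K' := (S + Yo).addStab with hK'
  have hKne : K.Nonempty := hBVne.addStab
  have hK'ne : K'.Nonempty := hSYne.addStab
  have hKdvd : #K ∣ Fintype.card H := hBVne.card_addStab_dvd_card_univ
  have hK'dvd : #K' ∣ Fintype.card H := hSYne.card_addStab_dvd_card_univ
  -- Kneser with the true stabilizers
  have hkK' : kneserLB #S #Yo #K' ≤ #(S + Yo) := kneserLB_card_addStab_le S Yo hSne hYne
  have hkK : kneserLB #(B i) #V #K ≤ #(B i + V) := kneserLB_card_addStab_le (B i) V (hB i) hVne
  have hVge : #(A i) * #(B i) * #(C i) + kneserLB #(A i) (∑ k ∈ univ.erase i, #(B k) * #(C k)) #K' ≤ #V := by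
    rw [hVcard, hWcard, ← hScard, ← hYcard]; omega
  have hmono := kneserLB_mono_right #(B i) #K hVge
  -- (|K|, |K'|) is a rescuing pair, hence (2, 2)
  obtain ⟨hK2, hK'2⟩ := h1 #K #K' hKne.card_pos hKdvd hK'ne.card_pos hK'dvd (by rw [← hZcard]; omega)
  -- structural Kneser inequalities
  have hknS := Literature.Combinatorics.Additive.add_kneser S Yo
  have hknB := Literature.Combinatorics.Additive.add_kneser (B i) V
  rw [← hK'] at hknS
  rw [← hK] at hknB
  have hYoK' : #Yo ≤ #(Yo + K') := card_le_card_add_right hK'ne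
  have hVK : #V ≤ #(V + K) := card_le_card_add_right hKne
  -- A-side: |S + K'| < 2 |S|
  have hkK2 : kneserLB #(B i) #V 2 ≤ #(B i + V) := by rw [← hK2]; exact hkK
  have h2' := h2 #V (Finset.card_le_univ _) (by rw [← hZcard]; omega)
  have hSlt : #(S + K') < 2 * #S := by
    rw [hK'2] at hknS
    rw [hScard]; rw [hVcard, hWcard, ← hYcard] at h2'
    omega
  -- B-side: |Bᵢ + K| < 2 |Bᵢ|
  have hkK'2 : kneserLB #(A i) (∑ k ∈ univ.erase i, #(B k) * #(C k)) 2 ≤ #(S + Yo) := by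
    rw [← hK'2, ← hScard, ← hYcard]; exact hkK'
  have hBlt : #(B i + K) < 2 * #(B i) := by
    rw [hK2] at hknB
    rw [hVcard, hWcard] at hVK
    rw [← hZcard] at h3
    omega
  -- the involutions of K and K' coincide
  obtain ⟨κ, hκ0, h2κ, hκK⟩ := exists_involution_of_card_addStab_eq_two hBVne (hK ▸ hK2)
  obtain ⟨κ', hκ'0, h2κ', hκ'K⟩ := exists_involution_of_card_addStab_eq_two hSYne (hK' ▸ hK'2)
  have hι : κ = κ' := eq_of_add_self_eq_zero h4 hκ0 hκ'0 h2κ h2κ'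
  rw [← hK] at hκK
  rw [← hK', ← hι] at hκ'K
  -- two points of Aᵢ and two points of Bᵢ differing by κ
  obtain ⟨x, hx, hxk⟩ := exists_add_mem_of_card_add_lt (Finset.zero_mem_addStab.2 hSYne |> (hK' ▸ ·)) hκ'K hSlt
  obtain ⟨b₁, hb₁, hb₂⟩ := exists_add_mem_of_card_add_lt (Finset.zero_mem_addStab.2 hBVne |> (hK ▸ ·)) hκK hBlt
  obtain ⟨a₁, ha₁, rfl⟩ := Finset.mem_image.1 hx
  obtain ⟨a₂, ha₂, ha₂e⟩ := Finset.mem_image.1 hxk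
  obtain ⟨c₀, hc₀⟩ := hC i
  -- (a₁ − a₂) + (b₁ − (b₁ + κ)) + (c₀ − c₀) = 0: the TPP of block i forces a₂ = a₁, i.e. κ = 0
  have hk : a₁ - a₂ = κ := by
    have h' : -a₂ = -a₁ + κ := by simpa only [zero_sub] using ha₂e
    rw [sub_eq_add_neg, h']; abel
  have hrel : (a₁ - a₂) + (b₁ - (b₁ + κ)) + (c₀ - c₀) = 0 := by
    rw [hk]; abel
  obtain ⟨-, -, h12, -, -⟩ := hS i i i a₂ ha₂ a₁ ha₁ (b₁ + κ) hb₂ b₁ hb₁ c₀ hc₀ c₀ hc₀ hrel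
  apply hκ0
  rw [← hk, h12, sub_self]

end Law

/-! ## §3 The decidable card-vector predicate (six readings) and the filter theorem -/

section Filter

/-- **Filter N19, one reading** on the card vectors (`C`-reading; `4 ∤ n` inside): some block `i` (another block present) satisfies (1) every rescuing pair is
`(2,2)`, (2) the A-side count, (3) the B-side count.  Same verdicts as HOME `pub-omega-stpp-1-g27/code/n19_filter.py` (`dead_C`). [folklore] -/
def N19Dead1 (n N : ℕ) (a b c : Fin N → ℕ) : Bool :=
  decide (¬ 4 ∣ n ∧ ∃ i j : Fin N, j ≠ i ∧
    (∀ d ∈ Nat.divisors n, ∀ d' ∈ Nat.divisors n,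
      n < ∑ k ∈ univ.erase i, a k * c k + kneserLB (b i) (a i * b i * c i + kneserLB (a i) (∑ k ∈ univ.erase i, b k * c k) d') d
        ∨ (d = 2 ∧ d' = 2)) ∧
    (∀ t : ℕ, t < n + 1 → kneserLB (b i) t 2 + ∑ k ∈ univ.erase i, a k * c k ≤ n →
      t + 2 < 2 * a i + a i * b i * c i + ∑ k ∈ univ.erase i, b k * c k) ∧
    (n + 2 < 2 * b i + ∑ k ∈ univ.erase i, a k * c k + a i * b i * c i + kneserLB (a i) (∑ k ∈ univ.erase i, b k * c k) 2))

/-- **Filter N19** on the card vectors: `N19Dead1` for one of the six role permutations. [folklore] -/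
def N19Dead (n N : ℕ) (a b c : Fin N → ℕ) : Bool :=
  N19Dead1 n N a b c || N19Dead1 n N b c a || N19Dead1 n N c a b ||
    N19Dead1 n N c b a || N19Dead1 n N b a c || N19Dead1 n N a c b

/-- **Filter N19, one reading (kernel).** [cite: Kneser1953] [cite: CohnKleinbergSzegedyUmans2005, Def. 5.1] -/
theorem not_isSTPP_of_n19Dead1 (hS : IsSTPP A B C) (hA : ∀ i, (A i).Nonempty) (hB : ∀ i, (B i).Nonempty)
    (hC : ∀ i, (C i).Nonempty) {n : ℕ} (hn : Fintype.card H = n) {a b c : Fin N → ℕ} (ha : ∀ i, #(A i) = a i)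
    (hb : ∀ i, #(B i) = b i) (hc : ∀ i, #(C i) = c i) (hdead : N19Dead1 n N a b c = true) : False := by
  obtain ⟨h4, i, j, hji, h1, h2, h3⟩ := of_decide_eq_true hdead
  have hI : (univ.erase i : Finset (Fin N)).Nonempty := ⟨j, Finset.mem_erase.2 ⟨hji, Finset.mem_univ _⟩⟩
  have hn0 : n ≠ 0 := by rw [← hn]; exact Fintype.card_ne_zero
  have eAC : ∑ k ∈ univ.erase i, #(A k) * #(C k) = ∑ k ∈ univ.erase i, a k * c k :=
    Finset.sum_congr rfl fun k _ => by rw [ha, hc]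
  have eBC : ∑ k ∈ univ.erase i, #(B k) * #(C k) = ∑ k ∈ univ.erase i, b k * c k :=
    Finset.sum_congr rfl fun k _ => by rw [hb, hc]
  refine involution_clash hS hA hB hC (hn ▸ h4) i hI ?_ ?_ ?_
  · intro d d' hd hdvd hd' hdvd' hle
    rw [hn] at hdvd hdvd' hle
    rw [ha, hb, hc, eAC, eBC] at hle
    rcases h1 d (Nat.mem_divisors.2 ⟨hdvd, hn0⟩) d' (Nat.mem_divisors.2 ⟨hdvd', hn0⟩) with h | h
    · omega
    · exact h
  · intro t htle ht
    rw [hn] at htle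
    rw [hn, hb, eAC] at ht
    have := h2 t (by omega) ht
    rw [ha, hb, hc, eBC]
    exact this
  · rw [hn, ha, hb, hc, eAC, eBC]
    exact h3

/-- **Filter N19 (kernel): an STPP family with non-empty sets in a finite abelian group `H` with `4 ∤ |H|` whose pattern is `N19Dead |H|` does not exist** —
six readings via `stpp_rotate` and `isSTPP_neg_reverse`. [cite: Kneser1953] [cite: CohnKleinbergSzegedyUmans2005, Def. 5.1] -/
theorem not_isSTPP_of_n19Dead (hS : IsSTPP A B C) (hA : ∀ i, (A i).Nonempty) (hB : ∀ i, (B i).Nonempty)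
    (hC : ∀ i, (C i).Nonempty) {n : ℕ} (hn : Fintype.card H = n) {a b c : Fin N → ℕ} (ha : ∀ i, #(A i) = a i)
    (hb : ∀ i, #(B i) = b i) (hc : ∀ i, #(C i) = c i) (hdead : N19Dead n N a b c = true) : False := by
  simp only [N19Dead, Bool.or_eq_true] at hdead
  have hR := isSTPP_neg_reverse hS
  have hnA : ∀ i, #((fun j => -(A j)) i) = a i := fun i => by rw [card_neg_family, ha]
  have hnB : ∀ i, #((fun j => -(B j)) i) = b i := fun i => by rw [card_neg_family, hb]
  have hnC : ∀ i, #((fun j => -(C j)) i) = c i := fun i => by rw [card_neg_family, hc]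
  rcases hdead with ((((h | h) | h) | h) | h) | h
  · exact not_isSTPP_of_n19Dead1 hS hA hB hC hn ha hb hc h
  · exact not_isSTPP_of_n19Dead1 (stpp_rotate hS) hB hC hA hn hb hc ha h
  · exact not_isSTPP_of_n19Dead1 (stpp_rotate (stpp_rotate hS)) hC hA hB hn hc ha hb h
  · exact not_isSTPP_of_n19Dead1 hR (nonempty_neg_family hC) (nonempty_neg_family hB) (nonempty_neg_family hA)
      hn hnC hnB hnA h
  · exact not_isSTPP_of_n19Dead1 (stpp_rotate hR) (nonempty_neg_family hB) (nonempty_neg_family hA)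
      (nonempty_neg_family hC) hn hnB hnA hnC h
  · exact not_isSTPP_of_n19Dead1 (stpp_rotate (stpp_rotate hR)) (nonempty_neg_family hA) (nonempty_neg_family hC)
      (nonempty_neg_family hB) hn hnA hnC hnB h

/-- Card-vector form with literal vectors: non-emptiness from positivity of the entries. [cite: Kneser1953] [cite: CohnKleinbergSzegedyUmans2005, Def. 5.1] -/
theorem not_isSTPP_of_n19Dead' (hS : IsSTPP A B C) {n : ℕ} (hn : Fintype.card H = n) (a b c : Fin N → ℕ)
    (ha : ∀ i, #(A i) = a i) (hb : ∀ i, #(B i) = b i) (hc : ∀ i, #(C i) = c i)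
    (hpos : ∀ i, 0 < a i ∧ 0 < b i ∧ 0 < c i) (hdead : N19Dead n N a b c = true) : False :=
  not_isSTPP_of_n19Dead hS (fun i => card_pos.1 ((ha i).symm ▸ (hpos i).1))
    (fun i => card_pos.1 ((hb i).symm ▸ (hpos i).2.1)) (fun i => card_pos.1 ((hc i).symm ▸ (hpos i).2.2))
    hn ha hb hc hdead

end Filter

/-! ## §4 Example -/

section Examples

/-- The ℤ₅₈ front leaf `{(2,4,4), (2,4,4)}` (`Σ abc = 64 > 58`), alive under every filter N7–N12 and N16–N18 (N18 is rescued exactly by the pair `(2,2)`: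
`8 + kLB(4, 32 + kLB(2, 16, 2), 2) = 8 + 50 = 58`), carries no STPP family in any abelian group of order `58`: the rescue forces both blocks' `A`- and `B`-sets
to contain pairs differing by the involution, against the TPP. [cite: Kneser1953] [cite: CohnKleinbergSzegedyUmans2005, Def. 5.1] -/
theorem no_isSTPP_card58_244_244 (hH : Fintype.card H = 58) (A B C : Fin 2 → Finset H) (hS : IsSTPP A B C)
    (hA : ∀ i, #(A i) = ![2, 2] i) (hB : ∀ i, #(B i) = ![4, 4] i) (hC : ∀ i, #(C i) = ![4, 4] i) : False :=
  not_isSTPP_of_n19Dead' hS hH _ _ _ hA hB hC (by decide) (by decide)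

end Examples

end Summit.MatrixMultiplication.OmegaCensus.CubeNB
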